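import Literature.MathematicalPhysics.QuantumLattice.XXZGroundStateSpontaneousOrder
import Literature.MathematicalPhysics.QuantumLattice.KomaTasakiTower
import Mathlib.Analysis.SpecialFunctions.Exponential
import Literature.MathematicalPhysics.QuantumLattice.HeisenbergGroundStateSymmetry
import Literature.MathematicalPhysics.QuantumLattice.HardCoreBosonGroundStateUnique
import Literature.MathematicalPhysics.QuantumLattice.SectorGroundProjContinuity
import Literature.MathematicalPhysics.QuantumLattice.FinDimSpectrumSectorGibbsLimit
import HarnessLib

/-!
# The Anderson tower of states BY NAME: Koma–Tasaki 1994, Corollary 2.11 for the Heisenberg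
# antiferromagnet (§3.2) and for hard-core lattice bosons (§3.3)

T. Koma, H. Tasaki, *Symmetry breaking and finite-size effects in quantum many-body systems*, J. Stat. Phys. **76**
(1994) 745–803 (`KomaTasaki1994`, held as `paper:arxiv-cond-mat_9708132`), §2.4 "Low-lying eigenstates in finite
systems":

> **Corollary 2.11.** For each nonvanishing integer `M` which satisfies the bound (2.24), one can find an eigenstate
> `Φ_Λ^{(M)}` of the Hamiltonian `H_Λ`. The state `Φ_Λ^{(M)}` is orthogonal to the ground state `Φ_Λ`, and the states
> `Φ_Λ^{(M)}` with distinct `M` are orthogonal to each other. The energy eigenvalue `E_Λ^{(M)}` of the state satisfies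
> `E_Λ^{(M)} - E_Λ^{(0)} ≤ c₃ M²/N`, where `c₃` is the constant introduced in Theorem 2.4.
> *Proof.* Since the reference state is an eigenstate of `C_Λ`, the commutation relations (2.16) imply that the
> variational states `Ψ_Λ^{(M)}` are orthogonal to the reference state … The desired result is then a consequence of
> the variational principle and Theorem 2.4. … "there exist ever increasing numbers of low-lying eigenstates whose
> excitation energies are bounded from above by a constant times `N⁻¹`. Such a finite size scaling behavior is
> characteristic for systems with a continuous symmetry breaking" [Anderson 1952; Bernu–Lhuillier–Pierre, Azaria et al.]

and §3.2 "Heisenberg antiferromagnet with Néel order" (`h_x` = halved bonds, `o^{(α)}_x = ±S^{(α)}_x` on the two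
sublattices, `C_Λ = Σ_x S^{(3)}_x`; "Assuming the existence of the Néel order, we can apply our low-lying states
theorems. The model has a desired `U(1) × ℤ₂` symmetry … with `γ = 1` … there are low-lying eigenstates with
excitation energies not larger than of order `N⁻¹`"), §3.3 "Bose–Einstein condensation in hard core Bose gas on
lattice".  H. Tasaki, J. Stat. Phys. **174** (2019) 735–761 (`Tasaki2019Tower`, `paper:arxiv-1807.05847`), Theorem 3.1
(3.9) / Corollary 3.2 (3.11) restate the tower `E_L^M ≤ E_L^{GS} + C₂M²/V` for `|M| ≤ C₁√V` under (A1)–(A5) and list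
(§3.2) the cases where the LRO hypothesis (A5) is a theorem.

## What this file proves (0 named facts, 0 sorry)

The tree PROVES KT94 Theorem 2.4 abstractly (`KomaTasaki.theorem_2_4_holds`, `KomaTasakiSSBTowerProofs.lean`, over
`KomaTasaki.U1System`) and has the XXZ / Heisenberg / hard-core-boson Koma–Tasaki systems (`XXZKT.u1System`,
`XXZGroundStateKomaTasakiSystem.lean`) and their ground-state long-range order (reflection positivity:
`xxzAF_ground_planar_of_ne_x`, `hardCoreBoson_ground_planar_of_ne_x`, `hardCoreBoson_ground_planar_spinHalf_x`), but
Corollary 2.11 had not been drawn FOR ANY MODEL: only the `M = 1` Horsch–von der Linden state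
(`HeisenbergNeelGapBound.lean`, `Barriers/…/LROForcesLowLyingStates.lean`).  Here:

* §0 (abstract, namespace `KomaTasaki`): `U1System.norm_trialState`, `U1System.C_trialState` (the trial state
  `Ψ^{(M)}` is a unit vector of `C`-charge `c + M`), `exists_unit_sector_energy_le` — Corollary 2.11's variational half
  for every `U1System` under i)–vi) and (2.24).
* §1 `exp_mul_eq_neg_of_ladder`: if `[X, B] = -aD`, `[X, D] = aB`, `e^{±ia} = -1`, then `e^X` ANTIcommutes with `B` and
  `D` (the ladder device of KT94 §5, here for an arbitrary pair).
* §2 (namespace `XXZKT`): hypothesis v) `u1System_comm` (`[O⁽¹⁾, O⁽²⁾] = iSᶻ_tot`, `γ = 1`) and hypothesis vi) FOR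
  QUANTUM SPINS: `rotation_one_mul_siteSpin` (the `π`-rotation `U = exp[iπO⁽¹⁾]`, `O⁽¹⁾ = Σ_x(-1)^{σx}Sˣ_x`, fixes every
  `Sˣ_x` and reverses every `Sʸ_x`, `Sᶻ_x` — by the ladder on `(Sʸ_x, Sᶻ_x)`, no factorisation of the exponential),
  `rotation_one_comm_hamiltonian` (`U` commutes with every XXZ Hamiltonian, any `J, Δ`, any sign pattern),
  `rotation_one_apply_eq_smul_of_hasUniqueGroundState` (`UΦ ∝ Φ` for a unique ground state).
* §3 one torus: `exists_unit_spinZSector_energy_le`, `lowestEnergyInSector_le_of_lro` (Corollary 2.11 for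
  `xxzHamiltonian n (torusGraph d L) J Δ` from a long-range-ordered `Sᶻ_tot = 0` ground eigenvector),
  `exists_eigenvector_lowestEnergyInSector` (the sector minimum is an eigenvalue), `hasUniqueGroundState_heisenbergAF`
  (Lieb–Mattis on the even torus).
* §4 **`heisenbergAF_andersonTower`** — `S = n/2`, `J > 0`, `d ≥ 2`, `(d, S) ≠ (2, ½)` (exactly where the tree proves
  Néel order): `∃ c₂ > 0, c₃, ∀ᶠ k, ∀ M ≠ 0, M² ≤ c₂N_k → E_k(M) - E_k(0) ≤ c₃M²/N_k` on `(ℤ/(2k+2)ℤ)^d`, with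
  `E_k(M) = lowestEnergyInSector n H_k M` (sector `Sᶻ_tot = M`, nonempty); `heisenbergAF_andersonTower_fixed` (fixed `M`,
  eventually in `k`); `heisenbergAF_andersonTower_eigenstates` (the eigenvectors `Φ^{(M)}`: unit, `Sᶻ_tot = M`,
  orthogonal to every ground state, eigenvalue `≤ E₀ + c₃M²/N`).
* §5 **`hardCoreBoson_andersonTower`** (`d ≥ 2`, spin ½, `J = -1`, `Δ = 0` = `hardCoreLatticeGas d L 0`: the tower in
  PARTICLE-NUMBER sectors `N/2 + M` of the half-filled hard-core Bose gas), `hardCoreBoson_andersonTower_eigenstates`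
  (eigenvectors with exactly `N/2 + M` bosons), `hardCoreBoson_ground_planar_zero_x` (KLS 1988 in every `d ≥ 2`),
  `hardCoreLatticeGas_zero_eq`.

**On the hypothesis `(h24 : KomaTasaki.theorem_2_4)`.**  Theorem 2.4 is the tree's NAMED FACT `KomaTasaki.theorem_2_4`
(`KomaTasakiSSB.lean`), discharged by `KomaTasaki.theorem_2_4_holds` (`KomaTasakiSSBTowerProofs.lean`, §5 of the paper);
following the Literature convention for discharged facts the model theorems take `(h24 : theorem_2_4)` and are fed
`theorem_2_4_holds` by the consumer (at the time of writing the hub carries no `.olean` for the five `KomaTasakiTower*` proof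
modules, so they cannot be imported here; the companion `AndersonTowerOfStatesUnconditional.lean` does exactly that
import and nothing else).  The constant `c₃` is `theorem_2_4.choose`, a function of `(h̄, ō, r, μ, γ)` alone — hence
independent of the volume, which is all the tower needs; its explicit value `24r²h̄/μ² + γh̄/(8μ²ō²)` is recorded in
`KomaTasaki.TowerState.core`.

WHAT THIS IS NOT: a finite-size SIGNATURE of long-range order for quantum spin / lattice boson models whose LRO is a
reflection-positivity theorem — not a statement about the Hubbard model, not an order-parameter floor, and not a
finite-size CRITERION (the implication runs LRO ⇒ tower; a certified tower gap bounds the LRO parameter only through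
the contrapositive of Theorem 2.4 with its crude constants).

## References
* [KomaTasaki1994] T. Koma, H. Tasaki, J. Stat. Phys. **76** (1994) 745–803: §2.3 (2.12)–(2.25) i)–vi), Theorem 2.4,
  §2.4 Corollary 2.11 and the discussion after it, §3.2 (Heisenberg antiferromagnet), §3.3 (hard-core Bose gas).
* [Tasaki2019Tower] H. Tasaki, J. Stat. Phys. **174** (2019) 735–761: §3.1 (A1)–(A5), §3.2, Theorem 3.1, Corollary 3.2.
* [KomaTasaki1993] T. Koma, H. Tasaki, Commun. Math. Phys. **158** (1993) 191–214: §1 (1.2), §2 iv), (7.22).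
* [LiebMattis1962] E. Lieb, D. Mattis, J. Math. Phys. **3** (1962) 749–751, Theorem 2 (uniqueness, `Sᶻ_tot = 0`).
* [AizenmanEtAl2004] M. Aizenman, E. H. Lieb, R. Seiringer, J. P. Solovej, J. Yngvason, Phys. Rev. A **70** (2004)
  023612, Appendix A (unique half-filled ground state of the hard-core lattice gas).
* [KLS1988PRL] T. Kennedy, E. H. Lieb, B. S. Shastry, Phys. Rev. Lett. **61** (1988) 2582–2584, Theorem.
* [Tasaki2020] H. Tasaki, *Physics and Mathematics of Quantum Many-Body Systems*, Springer 2020, §2.2, §2.4.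
* P. W. Anderson, Phys. Rev. **86** (1952) 694 (the tower of states; cited through [KomaTasaki1994, §2.4]).
-/

noncomputable section

open Matrix Finset Filter Topology WithLp Complex
open scoped ComplexOrder Matrix.Norms.L2Operator InnerProductSpace ComplexConjugate
open Literature.MathematicalPhysics.QuantumLattice Literature.MathematicalPhysics.QuantumLattice.SpinOperators
  Literature.MathematicalPhysics.QuantumLattice.KomaTasaki Literature.Probability.LatticeModels

namespace Literature.MathematicalPhysics.QuantumLattice

/-! ### §0. Koma–Tasaki 1994: the sector of the trial state `Ψ^{(M)}` and Corollary 2.11 abstractly -/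

namespace KomaTasaki

universe u v

variable {Λ : Type u} [Fintype Λ] {E : Type v} [NormedAddCommGroup E] [InnerProductSpace ℂ E]

namespace U1System

variable (sys : U1System Λ E)

/-- The trial state `Ψ^{(M)} = (O⁺)^MΦ/‖(O⁺)^MΦ‖` is a unit vector once `(O⁺)^MΦ ≠ 0`.
[cite: KomaTasaki1994, (2.19)] -/
theorem norm_trialState {M : ℤ} {Φ : E} (h : sys.orderPow M Φ ≠ 0) : ‖sys.trialState M Φ‖ = 1 := by
  rw [trialState, norm_smul, norm_inv, Complex.norm_real, norm_norm,
    inv_mul_cancel₀ (norm_ne_zero_iff.mpr h)]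

/-- **The trial state lies in the `C`-sector `c + M`**: `C Ψ^{(M)} = (c + M) Ψ^{(M)}` when `CΦ = cΦ`
(KT (2.16): `O^±` raise/lower the `U(1)` charge by one; this is what makes the `Ψ^{(M)}` with distinct `M`
mutually orthogonal and orthogonal to `Φ`). [cite: KomaTasaki1994, (2.16), proof of Corollary 2.11] -/
theorem C_trialState {Φ : E} {c : ℂ} (hC : sys.C Φ = c • Φ) (M : ℤ) :
    sys.C (sys.trialState M Φ) = (c + M) • sys.trialState M Φ := by
  rw [trialState, map_smul, sys.C_orderPow_apply hC M, smul_comm]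

end U1System

/-- **KT94 Corollary 2.11, the variational half, abstractly.**  Assume Theorem 2.4 (the tree's named fact
`theorem_2_4`, PROVED as `theorem_2_4_holds` in `KomaTasakiSSBTowerProofs.lean`; it is taken as a hypothesis here
and its constant is `theorem_2_4.choose`, a function `c₃(h̄, ō, r, μ, γ)` of the system's constants only).  Under
i)–vi) with `CΦ = 0` and the size condition (2.24) `M² ≤ c₂N`, for every `M ≠ 0` the unit vector `Ψ^{(M)}` lies in
the sector `C = M` and has energy expectation at most `E + c₃M²/N` — hence so is the lowest energy of `H` in that
sector ("the desired result is then a consequence of the variational principle and Theorem 2.4").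
[cite: KomaTasaki1994, Corollary 2.11 and its proof (§2.4), Theorem 2.4 (2.24)–(2.25)] -/
theorem exists_unit_sector_energy_le (h24 : theorem_2_4.{u, v}) [FiniteDimensional ℂ E] {sys : U1System Λ E}
    {Φ : E} {EΛ μ : ℝ} (hΦ : IsLROEigenstate sys Φ EΛ μ) (hC0 : sys.C Φ = 0) {γ : ℝ} (hγ : 0 < γ)
    (hv : sys.order 0 * sys.order 1 - sys.order 1 * sys.order 0 = (I * γ) • sys.C)
    (hUH : sys.rotation γ * sys.hamiltonian = sys.hamiltonian * sys.rotation γ)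
    (hUΦ : ∃ c : ℂ, sys.rotation γ Φ = c • Φ) {M : ℤ} (hM0 : M ≠ 0)
    (hM : (M : ℝ) ^ 2 ≤ min (μ ^ 2 / (192 * sys.r)) (sys.obar * μ / Real.sqrt (24 * γ)) * Fintype.card Λ) :
    ∃ Ψ : E, ‖Ψ‖ = 1 ∧ sys.C Ψ = (M : ℂ) • Ψ ∧
      (⟪Ψ, sys.hamiltonian Ψ⟫_ℂ).re ≤ EΛ + h24.choose sys.hbar sys.obar sys.r μ γ * (M : ℝ) ^ 2 / Fintype.card Λ := by
  obtain ⟨hne, hbd⟩ := h24.choose_spec sys Φ EΛ μ hΦ γ hγ hv hUH hUΦ M hM0 hM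
  have hC0' : sys.C Φ = (0 : ℂ) • Φ := by rw [hC0, zero_smul]
  refine ⟨sys.trialState M Φ, sys.norm_trialState hne, ?_, ?_⟩
  · rw [sys.C_trialState hC0' M, zero_add]
  · have h := (abs_le.mp hbd).2
    linarith

end KomaTasaki

/-! ### §1. A ladder lemma: `e^X` anticommutes with a pair `(B, D)` rotated by `ad_X` through a half-turn -/

namespace KomaTasaki

section Ladder

variable {E : Type*} [NormedAddCommGroup E] [InnerProductSpace ℂ E]

/-- If `U A = -A U` and `U B = -B U` then `U` commutes with `A B`. [folklore] -/
private theorem commute_mul_of_mul_eq_neg (U A B : E →L[ℂ] E) (hA : U * A = -(A * U)) (hB : U * B = -(B * U)) :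
    Commute U (A * B) := by
  change U * (A * B) = A * B * U
  rw [← mul_assoc, hA, neg_mul, mul_assoc, hB, mul_neg, neg_neg, mul_assoc]

variable [CompleteSpace E]

/-- Ladder relation for the exponential (a private copy of `exp_mul_eq_smul_mul_exp_of_comm_eq_smul` of
`KomaTasakiTowerExp.lean`): `X P - P X = c • P ⟹ exp X * P = exp c • (P * exp X)`. [folklore] -/
private theorem exp_mul_eq_smul_mul_exp_of_comm_eq_smul' (X P : E →L[ℂ] E) (c : ℂ)
    (h : X * P - P * X = c • P) :
    NormedSpace.exp X * P = Complex.exp c • (P * NormedSpace.exp X) := by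
  letI : NormedAlgebra ℚ (E →L[ℂ] E) := .restrictScalars ℚ ℂ _
  have hs : SemiconjBy P (X + c • (1 : E →L[ℂ] E)) X := by
    rw [SemiconjBy, mul_add, mul_smul_comm, mul_one]
    rw [sub_eq_iff_eq_add] at h
    rw [h]; abel
  have h1 : NormedSpace.exp (c • (1 : E →L[ℂ] E)) = Complex.exp c • (1 : E →L[ℂ] E) := by
    have h2 : c • (1 : E →L[ℂ] E) = algebraMap ℂ (E →L[ℂ] E) c :=
      (Algebra.algebraMap_eq_smul_one c).symm
    rw [h2, ← NormedSpace.algebraMap_exp_comm, Algebra.algebraMap_eq_smul_one,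
      Complex.exp_eq_exp_ℂ]
  have h3 : NormedSpace.exp (X + c • (1 : E →L[ℂ] E)) =
      NormedSpace.exp X * NormedSpace.exp (c • (1 : E →L[ℂ] E)) :=
    NormedSpace.exp_add_of_commute ((Commute.one_right X).smul_right c)
  have h4 := hs.exp_right.eq
  rw [h3, h1, mul_smul_comm, mul_one, mul_smul_comm] at h4
  exact h4.symm

/-- **Half-turn ladder.**  If `[X, B] = -a D` and `[X, D] = a B` with `e^{ia} = e^{-ia} = -1` (i.e. `a ≡ π`
`(mod 2π)`), then `P± = B ± iD` satisfy `[X, P±] = ±ia P±`, so `e^X P± = e^{±ia} P± e^X = -P± e^X`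
(the exponential ladder relation), whence `e^X B = -B e^X` and `e^X D = -D e^X`: the rotation
by `π` generated by `X` reverses the pair `(B, D)`.  (The device of KT94 §5 for `(O⁽²⁾, C)`, here for an
arbitrary pair.) [cite: KomaTasaki1994, §5 proof of Theorem 2.4] -/
theorem exp_mul_eq_neg_of_ladder (X B D : E →L[ℂ] E) (a : ℂ) (ha : Complex.exp (I * a) = -1)
    (ha' : Complex.exp (-(I * a)) = -1) (hB : X * B - B * X = -(a • D)) (hD : X * D - D * X = a • B) :
    NormedSpace.exp X * B = -(B * NormedSpace.exp X) ∧ NormedSpace.exp X * D = -(D * NormedSpace.exp X) := by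
  set Pp : E →L[ℂ] E := B + I • D with hPp
  set Pm : E →L[ℂ] E := B - I • D with hPm
  have hIaI : I * a * I = -a := by
    rw [mul_right_comm, I_mul_I, neg_one_mul]
  have hp : X * Pp - Pp * X = (I * a) • Pp := by
    have e1 : X * Pp - Pp * X = (X * B - B * X) + I • (X * D - D * X) := by
      rw [hPp, mul_add, add_mul, mul_smul_comm, smul_mul_assoc, smul_sub]; abel
    rw [e1, hB, hD]
    simp only [hPp, smul_add, smul_smul, hIaI, neg_smul]
    abel
  have hm : X * Pm - Pm * X = (-(I * a)) • Pm := by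
    have e1 : X * Pm - Pm * X = (X * B - B * X) - I • (X * D - D * X) := by
      rw [hPm, mul_sub, sub_mul, mul_smul_comm, smul_mul_assoc, smul_sub]; abel
    rw [e1, hB, hD]
    simp only [hPm, smul_sub, smul_smul, neg_mul, hIaI, neg_neg, neg_smul]
    abel
  have ep := exp_mul_eq_smul_mul_exp_of_comm_eq_smul' X Pp _ hp
  have em := exp_mul_eq_smul_mul_exp_of_comm_eq_smul' X Pm _ hm
  rw [ha, neg_one_smul] at ep
  rw [ha', neg_one_smul] at em
  have hB2 : Pp + Pm = (2 : ℂ) • B := by rw [hPp, hPm, two_smul]; abel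
  have hD2 : Pp - Pm = (2 * I) • D := by rw [hPp, hPm, mul_smul, two_smul]; abel
  constructor
  · have hadd : NormedSpace.exp X * (Pp + Pm) = -((Pp + Pm) * NormedSpace.exp X) := by
      rw [mul_add, add_mul, ep, em, neg_add]
    rw [hB2, mul_smul_comm, smul_mul_assoc, ← smul_neg] at hadd
    exact smul_right_injective (E →L[ℂ] E) two_ne_zero hadd
  · have hsub : NormedSpace.exp X * (Pp - Pm) = -((Pp - Pm) * NormedSpace.exp X) := by
      rw [mul_sub, sub_mul, ep, em, neg_sub_neg, neg_sub]
    rw [hD2, mul_smul_comm, smul_mul_assoc, ← smul_neg] at hsub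
    exact smul_right_injective (E →L[ℂ] E) (mul_ne_zero two_ne_zero I_ne_zero) hsub

end Ladder

end KomaTasaki

/-! ### §2. The XXZ system: hypotheses v) and vi) of KT94 Theorem 2.4 for quantum spins -/

namespace XXZKT

section Graph

variable {Λ : Type*} [Fintype Λ] [DecidableEq Λ] (n : ℕ) (σ : Λ → ℕ)

/-- A fragment of the Levi-Civita table used below. [folklore] -/
private theorem lc_values :
    leviCivita 0 1 0 = 0 ∧ leviCivita 0 1 1 = 0 ∧ leviCivita 0 1 2 = 1 ∧
    leviCivita 0 0 0 = 0 ∧ leviCivita 0 0 1 = 0 ∧ leviCivita 0 0 2 = 0 ∧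
    leviCivita 1 0 0 = 0 ∧ leviCivita 1 0 1 = 0 ∧ leviCivita 1 0 2 = -1 ∧
    leviCivita 2 0 0 = 0 ∧ leviCivita 2 0 1 = 1 ∧ leviCivita 2 0 2 = 0 := by
  decide

omit [Fintype Λ] [DecidableEq Λ] in
/-- The sign `(-1)^{σx}` is `1` or `-1`. [cite: KomaTasaki1993, §1 (1.2)] -/
theorem stagSign_eq_one_or (x : Λ) : stagSign σ x = 1 ∨ stagSign σ x = -1 :=
  neg_one_pow_eq_or ℝ (σ x)

/-- **v) for quantum spins: `[O⁽¹⁾, O⁽²⁾] = i C`** (`γ = 1`) with `O⁽¹⁾ = Σ_x(-1)^{σx}Sˣ_x`, `O⁽²⁾ = Σ_x(-1)^{σx}Sʸ_x`,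
`C = Sᶻ_tot` (the signs square to one; KT93 (7.22)). [cite: KomaTasaki1994, Theorem 2.4 (2.23), §3.2 ("with γ = 1")]
[cite: KomaTasaki1993, (7.22)] -/
theorem stagSpin_zero_comm_stagSpin_one :
    (stagSpin n σ 0 * stagSpin n σ 1 - stagSpin n σ 1 * stagSpin n σ 0 : Op Λ (n + 1)) =
      Complex.I • totalSpin n 2 := by
  obtain ⟨e010, e011, e012, -⟩ := lc_values
  rw [stagSpin_comm_stagSpin]
  simp only [Fin.sum_univ_three, e010, e011, e012, Int.cast_zero, Int.cast_one, zero_smul, one_smul, zero_add]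

/-- `[O⁽¹⁾, Sˣ_x] = 0`. [cite: KomaTasaki1993, §2 iv)] -/
theorem stagSpin_zero_commute_siteSpin_zero (x : Λ) :
    Commute (stagSpin n σ 0 : Op Λ (n + 1)) (siteSpin n x 0) := by
  obtain ⟨-, -, -, e000, e001, e002, -⟩ := lc_values
  have h := siteSpin_comm_stagSpin n σ x 0 0
  simp only [Fin.sum_univ_three, e000, e001, e002, Int.cast_zero, zero_smul, add_zero, smul_zero] at h
  rw [sub_eq_zero] at h
  exact h.symm

/-- `[O⁽¹⁾, Sʸ_x] = (-1)^{σx} i Sᶻ_x`. [cite: KomaTasaki1993, §2 iv), (7.22)] -/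
theorem stagSpin_zero_comm_siteSpin_one (x : Λ) :
    (stagSpin n σ 0 * siteSpin n x 1 - siteSpin n x 1 * stagSpin n σ 0 : Op Λ (n + 1)) =
      (stagSign σ x : ℂ) • (Complex.I • siteSpin n x 2) := by
  obtain ⟨-, -, -, -, -, -, e100, e101, e102, -⟩ := lc_values
  have h := siteSpin_comm_stagSpin n σ x 1 0
  simp only [Fin.sum_univ_three, e100, e101, e102, Int.cast_zero, Int.cast_neg, Int.cast_one, zero_smul,
    zero_add, neg_smul, one_smul, smul_neg] at h
  rw [← neg_sub, h, neg_neg]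

/-- `[O⁽¹⁾, Sᶻ_x] = -(-1)^{σx} i Sʸ_x`. [cite: KomaTasaki1993, §2 iv), (7.22)] -/
theorem stagSpin_zero_comm_siteSpin_two (x : Λ) :
    (stagSpin n σ 0 * siteSpin n x 2 - siteSpin n x 2 * stagSpin n σ 0 : Op Λ (n + 1)) =
      -((stagSign σ x : ℂ) • (Complex.I • siteSpin n x 1)) := by
  obtain ⟨-, -, -, -, -, -, -, -, -, e200, e201, e202⟩ := lc_values
  have h := siteSpin_comm_stagSpin n σ x 2 0
  simp only [Fin.sum_univ_three, e200, e201, e202, Int.cast_zero, Int.cast_one, zero_smul, one_smul,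
    zero_add, add_zero] at h
  rw [← neg_sub, h]

end Graph

section Torus

variable (d L n : ℕ) [NeZero L]

/-- **v) for the instance**: `O⁽¹⁾_sys O⁽²⁾_sys - O⁽²⁾_sys O⁽¹⁾_sys = (i·1) C_sys`. [cite: KomaTasaki1994, Theorem 2.4 (2.23), §3.2] -/
theorem u1System_comm (J Δ : ℝ) (σ : TorusSite d L → ℕ) :
    (u1System d L n J Δ σ).order 0 * (u1System d L n J Δ σ).order 1 -
        (u1System d L n J Δ σ).order 1 * (u1System d L n J Δ σ).order 0 =
      (I * ((1 : ℝ) : ℂ)) • (u1System d L n J Δ σ).C := by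
  rw [u1System_order_zero, u1System_order_one, u1System_C, ← map_mul, ← map_mul, ← map_sub,
    stagSpin_zero_comm_stagSpin_one, map_smul, Complex.ofReal_one, mul_one]

/-- **vi), algebraic part, on the sites: the `π`-rotation `U = exp[iπO⁽¹⁾]` fixes every `Sˣ_x` and reverses every
`Sʸ_x`, `Sᶻ_x`** — by the half-turn ladder applied to `(Sʸ_x, Sᶻ_x)`, `[iπO⁽¹⁾, Sʸ_x] = -π(-1)^{σx}Sᶻ_x`,
`[iπO⁽¹⁾, Sᶻ_x] = π(-1)^{σx}Sʸ_x`, `e^{±iπ} = -1`; no factorisation of the exponential is used.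
[cite: KomaTasaki1994, §2.3 vi), §3.2] -/
theorem rotation_one_mul_siteSpin (J Δ : ℝ) (σ : TorusSite d L → ℕ) (x : TorusSite d L) :
    (u1System d L n J Δ σ).rotation 1 *
          toEuclideanCLM (n := TensorIndex (TorusSite d L) (n + 1)) (𝕜 := ℂ) (siteSpin n x 0) =
        toEuclideanCLM (n := TensorIndex (TorusSite d L) (n + 1)) (𝕜 := ℂ) (siteSpin n x 0) *
          (u1System d L n J Δ σ).rotation 1 ∧
      (u1System d L n J Δ σ).rotation 1 *
          toEuclideanCLM (n := TensorIndex (TorusSite d L) (n + 1)) (𝕜 := ℂ) (siteSpin n x 1) =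
        -(toEuclideanCLM (n := TensorIndex (TorusSite d L) (n + 1)) (𝕜 := ℂ) (siteSpin n x 1) *
          (u1System d L n J Δ σ).rotation 1) ∧
      (u1System d L n J Δ σ).rotation 1 *
          toEuclideanCLM (n := TensorIndex (TorusSite d L) (n + 1)) (𝕜 := ℂ) (siteSpin n x 2) =
        -(toEuclideanCLM (n := TensorIndex (TorusSite d L) (n + 1)) (𝕜 := ℂ) (siteSpin n x 2) *
          (u1System d L n J Δ σ).rotation 1) := by
  set toE := toEuclideanCLM (n := TensorIndex (TorusSite d L) (n + 1)) (𝕜 := ℂ) with htoE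
  set t : ℂ := (↑(Real.pi / Real.sqrt 1) : ℂ) with ht
  set X : SpinSpace (TorusSite d L) (n + 1) →L[ℂ] SpinSpace (TorusSite d L) (n + 1) :=
    (I * t) • (u1System d L n J Δ σ).order 0 with hX
  have hU : (u1System d L n J Δ σ).rotation 1 = NormedSpace.exp X := rfl
  have hO : (u1System d L n J Δ σ).order 0 = toE (stagSpin n σ 0) := u1System_order_zero d L n J Δ σ
  have ht1 : t = Real.pi := by rw [ht, Real.sqrt_one, div_one]
  set s : ℝ := stagSign σ x with hs
  -- the two commutators with `X`, computed on matrices and transported by `toEuclideanCLM`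
  have hXm : X = toE ((I * t) • stagSpin n σ 0) := by
    rw [hX, hO]; exact (map_smul _ _ _).symm
  have hcoef : I * t * (s : ℂ) * I = -(t * s) := by
    have : I * t * (s : ℂ) * I = I * I * (t * s) := by ring
    rw [this, I_mul_I, neg_one_mul]
  have mB : ((I * t) • stagSpin n σ 0 * siteSpin n x 1 - siteSpin n x 1 * ((I * t) • stagSpin n σ 0) :
      Op (TorusSite d L) (n + 1)) = -((t * s) • siteSpin n x 2) := by
    rw [Matrix.smul_mul, Matrix.mul_smul, ← smul_sub, stagSpin_zero_comm_siteSpin_one, smul_smul, smul_smul, ← hs,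
      hcoef, neg_smul]
  have mD : ((I * t) • stagSpin n σ 0 * siteSpin n x 2 - siteSpin n x 2 * ((I * t) • stagSpin n σ 0) :
      Op (TorusSite d L) (n + 1)) = (t * s) • siteSpin n x 1 := by
    rw [Matrix.smul_mul, Matrix.mul_smul, ← smul_sub, stagSpin_zero_comm_siteSpin_two, smul_neg, smul_smul, smul_smul,
      ← hs, hcoef, neg_smul, neg_neg]
  have hB : X * toE (siteSpin n x 1) - toE (siteSpin n x 1) * X = -((t * s) • toE (siteSpin n x 2)) := by
    rw [hXm, ← map_mul, ← map_mul, ← map_sub, mB, map_neg, map_smul]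
  have hD : X * toE (siteSpin n x 2) - toE (siteSpin n x 2) * X = (t * s) • toE (siteSpin n x 1) := by
    rw [hXm, ← map_mul, ← map_mul, ← map_sub, mD, map_smul]
  -- `e^{± i t s} = -1`
  have e1 : Complex.exp (I * Real.pi) = -1 := by rw [mul_comm]; exact Complex.exp_pi_mul_I
  have e2 : Complex.exp (-(I * Real.pi)) = -1 := by rw [Complex.exp_neg, e1]; norm_num
  have hexp : Complex.exp (I * (t * s)) = -1 ∧ Complex.exp (-(I * (t * s))) = -1 := by
    rw [ht1, hs]
    rcases stagSign_eq_one_or σ x with h1 | h1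
    · rw [h1, Complex.ofReal_one, mul_one]
      exact ⟨e1, e2⟩
    · rw [h1, Complex.ofReal_neg, Complex.ofReal_one, mul_neg, mul_one, mul_neg, neg_neg]
      exact ⟨e2, e1⟩
  have hpair := KomaTasaki.exp_mul_eq_neg_of_ladder X (toE (siteSpin n x 1)) (toE (siteSpin n x 2)) (t * s)
    hexp.1 hexp.2 hB hD
  refine ⟨?_, ?_, ?_⟩
  · -- `Sˣ_x` commutes with `X`
    have hc : Commute X (toE (siteSpin n x 0)) := by
      rw [hX, hO]
      exact (commute_toEuclideanCLM_of_commute (stagSpin_zero_commute_siteSpin_zero n σ x)).smul_left _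
    rw [hU]
    exact hc.exp_left.eq
  · rw [hU]; exact hpair.1
  · rw [hU]; exact hpair.2

/-- **vi) for quantum spins: the `π`-rotation commutes with the XXZ Hamiltonian** (every `J`, `Δ`, every sign pattern
`σ`): each bond `Sˣ_xSˣ_y + Sʸ_xSʸ_y + ΔSᶻ_xSᶻ_y` is fixed since `U` reverses BOTH `Sʸ`'s and BOTH `Sᶻ`'s
(`U = ±` the global rotation by `π` about the first spin axis). [cite: KomaTasaki1994, §2.3 vi), §3.2] -/
theorem rotation_one_comm_hamiltonian (J Δ : ℝ) (σ : TorusSite d L → ℕ) :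
    (u1System d L n J Δ σ).rotation 1 * (u1System d L n J Δ σ).hamiltonian =
      (u1System d L n J Δ σ).hamiltonian * (u1System d L n J Δ σ).rotation 1 := by
  set toE := toEuclideanCLM (n := TensorIndex (TorusSite d L) (n + 1)) (𝕜 := ℂ) with htoE
  set U := (u1System d L n J Δ σ).rotation 1 with hUdef
  have hsite := rotation_one_mul_siteSpin d L n J Δ σ
  -- `U` commutes with every `S^α_x S^α_y`
  have hαα : ∀ (α : Fin 3) (x y : TorusSite d L), Commute U (toE (siteSpin n x α * siteSpin n y α)) := by
    intro α x y
    rw [map_mul]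
    fin_cases α
    · exact Commute.mul_right (hsite x).1 (hsite y).1
    · exact KomaTasaki.commute_mul_of_mul_eq_neg U _ _ (hsite x).2.1 (hsite y).2.1
    · exact KomaTasaki.commute_mul_of_mul_eq_neg U _ _ (hsite x).2.2 (hsite y).2.2
  have hbond : ∀ (α : Fin 3) (x y : TorusSite d L), Commute U (toE (spinBond n α x y)) := by
    intro α x y
    rw [spinBond, map_smul, map_add]
    exact ((hαα α x y).add_right (hαα α y x)).smul_right _
  change Commute U (u1System d L n J Δ σ).hamiltonian
  rw [u1System_hamiltonian, xxzHamiltonian, map_smul, map_sum]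
  refine Commute.smul_right (Commute.sum_right _ _ _ fun e _ => ?_) _
  induction e using Sym2.ind with
  | h x y =>
    rw [Sym2.lift_mk, map_add, map_add, map_smul]
    exact ((hbond 0 x y).add_right (hbond 1 x y)).add_right ((hbond 2 x y).smul_right _)

/-- **vi), state part: `UΦ ∝ Φ` whenever the ground state is unique** — `U` commutes with `H`, so it maps the
(one-dimensional) ground space into itself. [cite: KomaTasaki1994, §2.3 vi), §3.2 ("the ground state … is rigorously
known to be unique")] [cite: Tasaki2019Tower, §3.2 (A4)] -/
theorem rotation_one_apply_eq_smul_of_hasUniqueGroundState (J Δ : ℝ) (σ : TorusSite d L → ℕ)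
    {Φ : TensorIndex (TorusSite d L) (n + 1) → ℂ} (hΦ0 : Φ ≠ 0)
    (hH : xxzHamiltonian n (torusGraph d L) J Δ *ᵥ Φ =
      ((xxzHamiltonian n (torusGraph d L) J Δ).groundEnergy : ℂ) • Φ)
    (huniq : (xxzHamiltonian n (torusGraph d L) J Δ).HasUniqueGroundState) :
    ∃ c : ℂ, (u1System d L n J Δ σ).rotation 1 (toLp 2 Φ) = c • (toLp 2 Φ : SpinSpace (TorusSite d L) (n + 1)) := by
  set H := xxzHamiltonian n (torusGraph d L) J Δ with hHdef
  set U := (u1System d L n J Δ σ).rotation 1 with hUdef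
  set v : SpinSpace (TorusSite d L) (n + 1) := U (toLp 2 Φ) with hv
  have hUH := rotation_one_comm_hamiltonian d L n J Δ σ
  rw [u1System_hamiltonian, ← hUdef, ← hHdef] at hUH
  -- `v` is again a ground-state vector (or zero)
  have h1 : U (toEuclideanCLM (n := TensorIndex (TorusSite d L) (n + 1)) (𝕜 := ℂ) H (toLp 2 Φ)) =
      toEuclideanCLM (n := TensorIndex (TorusSite d L) (n + 1)) (𝕜 := ℂ) H (U (toLp 2 Φ)) :=
    congrArg (fun T : SpinSpace (TorusSite d L) (n + 1) →L[ℂ] SpinSpace (TorusSite d L) (n + 1) => T (toLp 2 Φ)) hUH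
  have hHv : toEuclideanCLM (n := TensorIndex (TorusSite d L) (n + 1)) (𝕜 := ℂ) H v = (H.groundEnergy : ℂ) • v := by
    rw [hv, ← h1, toEuclideanCLM_toLp, hH, toLp_smul, map_smul]
  have hmem : ofLp v ∈ H.groundSpace := by
    rw [Matrix.mem_groundSpace_iff, ← ofLp_toEuclideanCLM, hHv, WithLp.ofLp_smul]
  have hΦmem : Φ ∈ H.groundSpace := (Matrix.mem_groundSpace_iff _ _).2 hH
  have hne : (⟨Φ, hΦmem⟩ : H.groundSpace) ≠ 0 := fun h => hΦ0 (congrArg Subtype.val h)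
  have h1 : Module.finrank ℂ H.groundSpace = 1 := huniq
  obtain ⟨c, hc⟩ := (finrank_eq_one_iff_of_nonzero' _ hne).1 h1 ⟨ofLp v, hmem⟩
  refine ⟨c, ?_⟩
  have hc' : c • Φ = ofLp v := by simpa using congrArg Subtype.val hc
  calc v = toLp 2 (ofLp v) := (toLp_ofLp 2 v).symm
    _ = toLp 2 (c • Φ) := by rw [hc']
    _ = c • (toLp 2 Φ : SpinSpace (TorusSite d L) (n + 1)) := toLp_smul _ _ _

/-! ### §3. KT94 Corollary 2.11 for the XXZ system on one torus -/

/-- An `H` commuting with `Sᶻ_tot` maps every magnetisation sector into itself (block diagonalisation by the conserved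
magnetisation). [cite: Tasaki2020, §2.2 (conserved `Ŝ_tot^{(3)}`, eq. (2.2.14)) and §2.4 eq. (2.4.5)] [cite: KomaTasaki1994, §2.3 (2.12)] -/
theorem mulVec_mem_spinZSector_of_commute {Λ : Type*} [Fintype Λ] [DecidableEq Λ] {n : ℕ} {H : Op Λ (n + 1)}
    (hC : Commute H (totalSpin n 2)) {M : ℝ} {v : TensorIndex Λ (n + 1) → ℂ} (hv : v ∈ spinZSector (Λ := Λ) n M) :
    H *ᵥ v ∈ spinZSector (Λ := Λ) n M := by
  simp only [spinZSector, Module.End.mem_eigenspace_iff, Matrix.toLin'_apply] at hv ⊢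
  rw [Matrix.mulVec_mulVec, ← hC.eq, ← Matrix.mulVec_mulVec, hv, Matrix.mulVec_smul]

/-- **The lowest energy in a magnetisation sector is an eigenvalue** (for `H` Hermitian commuting with `Sᶻ_tot` and a
nonempty sector): it is attained by a unit eigenvector of `H` inside the sector — the "energy eigenstate `Φ_Λ^{(M)}`"
of KT94 Corollary 2.11 (variational principle in the invariant subspace). [cite: KomaTasaki1994, proof of Corollary 2.11]
[cite: Tasaki2020, §2.2] -/
theorem exists_eigenvector_lowestEnergyInSector {Λ : Type*} [Fintype Λ] [DecidableEq Λ] {n : ℕ} {H : Op Λ (n + 1)}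
    (hH : H.IsHermitian) (hC : Commute H (totalSpin n 2)) {M : ℝ} (hne : spinZSector (Λ := Λ) n M ≠ ⊥) :
    ∃ Ψ : TensorIndex Λ (n + 1) → ℂ, Ψ ∈ spinZSector (Λ := Λ) n M ∧ star Ψ ⬝ᵥ Ψ = 1 ∧
      H *ᵥ Ψ = ((lowestEnergyInSector n H M : ℝ) : ℂ) • Ψ :=
  exists_unit_eigen_minEnergyOn hH _ (fun _ hv => mulVec_mem_spinZSector_of_commute hC hv) hne

/-- **KT94 COROLLARY 2.11 FOR QUANTUM SPINS, ONE TORUS** (conditional on the tree's named fact `theorem_2_4`, i.e. fed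
`KomaTasaki.theorem_2_4_holds`).  On `(ℤ/Lℤ)^d` let `H = xxzHamiltonian n (torusGraph d L) J Δ` (any `J, Δ`, spin `n/2`),
`O⁽¹⁾ = Σ_x(-1)^{σx}Sˣ_x` (any sign pattern `σ`), and let `Φ` be a unit eigenvector `HΦ = E₀Φ` with `Sᶻ_totΦ = 0`,
long-range order `(μōN)² ≤ Re Φ†(O⁽¹⁾)²Φ` (`μ > 0`, `ō = sNorm n`) and `UΦ ∝ Φ` for the `π`-rotation `U = exp[iπO⁽¹⁾]`.
Then for every integer `M ≠ 0` with `M² ≤ c₂N`, `c₂ = min{μ²/(192r), ōμ/√24}`, `r = 2d+2` (KT (2.24)), there is a unit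
vector `Ψ` in the magnetisation sector `Sᶻ_tot = M` with `Re Ψ†HΨ ≤ E₀ + c₃M²/N`, `c₃ = c₃(h̄, ō, r, μ, 1)` the constant of
Theorem 2.4.  Hypotheses i)–iii) and (2.14) are `XXZKT.u1System`, v) (`γ = 1`) is `u1System_comm`, vi) is
`rotation_one_comm_hamiltonian` + the assumption `UΦ ∝ Φ`. [cite: KomaTasaki1994, Corollary 2.11, Theorem 2.4, §3.2] -/
theorem exists_unit_spinZSector_energy_le (h24 : KomaTasaki.theorem_2_4.{0, 0}) (J Δ : ℝ) (σ : TorusSite d L → ℕ)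
    {Φ : TensorIndex (TorusSite d L) (n + 1) → ℂ} {E₀ μ : ℝ} (hΦ : star Φ ⬝ᵥ Φ = 1)
    (hH : xxzHamiltonian n (torusGraph d L) J Δ *ᵥ Φ = (E₀ : ℂ) • Φ) (hC0 : totalSpin n 2 *ᵥ Φ = 0) (hμ : 0 < μ)
    (hlro : (μ * sNorm n * (Fintype.card (TorusSite d L) : ℝ)) ^ 2 ≤
      (star Φ ⬝ᵥ (stagSpin n σ 0 *ᵥ (stagSpin n σ 0 *ᵥ Φ))).re)
    (hUΦ : ∃ c : ℂ, (u1System d L n J Δ σ).rotation 1 (toLp 2 Φ) = c • (toLp 2 Φ : SpinSpace (TorusSite d L) (n + 1)))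
    {M : ℤ} (hM0 : M ≠ 0)
    (hM : (M : ℝ) ^ 2 ≤ min (μ ^ 2 / (192 * ((2 * d + 2 : ℕ) : ℝ))) (sNorm n * μ / Real.sqrt 24) *
      Fintype.card (TorusSite d L)) :
    ∃ Ψ : TensorIndex (TorusSite d L) (n + 1) → ℂ, star Ψ ⬝ᵥ Ψ = 1 ∧ totalSpin n 2 *ᵥ Ψ = (M : ℂ) • Ψ ∧
      (star Ψ ⬝ᵥ (xxzHamiltonian n (torusGraph d L) J Δ *ᵥ Ψ)).re ≤
        E₀ + h24.choose (hbar d n J Δ) (sNorm n) (2 * d + 2) μ 1 * (M : ℝ) ^ 2 / Fintype.card (TorusSite d L) := by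
  set sys := u1System d L n J Δ σ with hsys
  have hC0ν : totalSpin n 2 *ᵥ Φ = (0 : ℂ) • Φ := by rw [hC0, zero_smul]
  have hLRO : KomaTasaki.IsLROEigenstate sys (toLp 2 Φ) E₀ μ :=
    u1System_isLROEigenstate d L n J Δ σ hΦ hH hC0ν hμ hlro
  have hC0' : sys.C (toLp 2 Φ) = 0 := by
    rw [hsys, u1System_C, toEuclideanCLM_toLp, hC0, toLp_zero]
  have hv := u1System_comm d L n J Δ σ
  have hUH := rotation_one_comm_hamiltonian d L n J Δ σ
  have hM' : (M : ℝ) ^ 2 ≤ min (μ ^ 2 / (192 * sys.r)) (sys.obar * μ / Real.sqrt (24 * 1)) *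
      Fintype.card (TorusSite d L) := by
    rw [mul_one, hsys, u1System_r, u1System_obar]; exact hM
  obtain ⟨Ψ, hΨ1, hCΨ, hE⟩ :=
    KomaTasaki.exists_unit_sector_energy_le h24 hLRO hC0' one_pos hv hUH hUΦ hM0 hM'
  refine ⟨ofLp Ψ, ?_, ?_, ?_⟩
  · rw [← inner_toLp_toLp_eq_dotProduct, toLp_ofLp, inner_self_eq_norm_sq_to_K, hΨ1]; norm_num
  · have h := congrArg ofLp hCΨ
    rw [hsys, u1System_C, ofLp_toEuclideanCLM, WithLp.ofLp_smul] at h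
    exact h
  · rw [hsys, u1System_hamiltonian] at hE
    rw [← inner_toLp_toLp_eq_dotProduct, ← toEuclideanCLM_toLp, toLp_ofLp]
    exact hE

/-- **KT94 Corollary 2.11 on one torus, sector-energy form**: under the same hypotheses,
`E(M) - E₀ ≤ c₃M²/N` for the lowest energy `E(M) = lowestEnergyInSector n H M` in the magnetisation sector `Sᶻ_tot = M`
(the variational principle `minEnergyOn_le_rayleigh_of_mem`). [cite: KomaTasaki1994, Corollary 2.11 (the bound `E^{(M)} - E^{(0)} ≤ c₃M²/N`)] -/
theorem lowestEnergyInSector_le_of_lro (h24 : KomaTasaki.theorem_2_4.{0, 0}) (J Δ : ℝ) (σ : TorusSite d L → ℕ)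
    {Φ : TensorIndex (TorusSite d L) (n + 1) → ℂ} {E₀ μ : ℝ} (hΦ : star Φ ⬝ᵥ Φ = 1)
    (hH : xxzHamiltonian n (torusGraph d L) J Δ *ᵥ Φ = (E₀ : ℂ) • Φ) (hC0 : totalSpin n 2 *ᵥ Φ = 0) (hμ : 0 < μ)
    (hlro : (μ * sNorm n * (Fintype.card (TorusSite d L) : ℝ)) ^ 2 ≤
      (star Φ ⬝ᵥ (stagSpin n σ 0 *ᵥ (stagSpin n σ 0 *ᵥ Φ))).re)
    (hUΦ : ∃ c : ℂ, (u1System d L n J Δ σ).rotation 1 (toLp 2 Φ) = c • (toLp 2 Φ : SpinSpace (TorusSite d L) (n + 1)))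
    {M : ℤ} (hM0 : M ≠ 0)
    (hM : (M : ℝ) ^ 2 ≤ min (μ ^ 2 / (192 * ((2 * d + 2 : ℕ) : ℝ))) (sNorm n * μ / Real.sqrt 24) *
      Fintype.card (TorusSite d L)) :
    spinZSector (Λ := TorusSite d L) n (M : ℝ) ≠ ⊥ ∧
      lowestEnergyInSector n (xxzHamiltonian n (torusGraph d L) J Δ) M ≤
        E₀ + h24.choose (hbar d n J Δ) (sNorm n) (2 * d + 2) μ 1 * (M : ℝ) ^ 2 / Fintype.card (TorusSite d L) := by
  obtain ⟨Ψ, hΨ1, hCΨ, hE⟩ := exists_unit_spinZSector_energy_le d L n h24 J Δ σ hΦ hH hC0 hμ hlro hUΦ hM0 hM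
  have hmem : Ψ ∈ spinZSector (Λ := TorusSite d L) n (M : ℝ) := by
    simp only [spinZSector, Module.End.mem_eigenspace_iff, Matrix.toLin'_apply, Complex.ofReal_intCast]
    exact hCΨ
  have hΨ0 : Ψ ≠ 0 := by
    intro h; rw [h, dotProduct_zero] at hΨ1; exact zero_ne_one hΨ1
  refine ⟨fun hbot => hΨ0 ((Submodule.eq_bot_iff _).1 hbot Ψ hmem), ?_⟩
  exact (minEnergyOn_le_rayleigh_of_mem (xxzHamiltonian_isHermitian n _ J Δ) _ hmem hΨ1).trans hE

/-! ### §4. THE ANDERSON TOWER OF THE HEISENBERG ANTIFERROMAGNET (KT94 §3.2) -/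

section Heisenberg

/-- `xxzHamiltonian n G J 1 = heisenbergHamiltonian n G J`. [cite: Tasaki2020, §2.4 (remarks after eq. (2.4.1))] -/
private theorem xxzHamiltonian_one_eq_heisenberg {Λ : Type*} [Fintype Λ] [DecidableEq Λ] (n : ℕ)
    (G : SimpleGraph Λ) [DecidableRel G.Adj] (J : ℝ) :
    xxzHamiltonian n G J 1 = heisenbergHamiltonian n G J := by
  rw [xxzHamiltonian, heisenbergHamiltonian]
  congr 1
  refine sum_congr rfl fun e _ => ?_
  induction e using Sym2.ind with
  | h x y =>
    simp only [Sym2.lift_mk, spinDotSym_mk, spinDot, Fin.sum_univ_three, Complex.ofReal_one, one_smul]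

/-- **The ground state of the Heisenberg antiferromagnet on the even torus is unique** (Lieb–Mattis: the even torus
`(ℤ/Lℤ)^d`, `d ≥ 1`, `2 ∣ L`, is connected and bipartite with equinumerous parity sublattices).
[cite: LiebMattis1962, Theorem 2] [cite: KomaTasaki1994, §3.2 (3.3) ("rigorously known to be unique")] -/
theorem hasUniqueGroundState_heisenbergAF (hd : 1 ≤ d) (hL : 2 ∣ L) {J : ℝ} (hJ : 0 < J) :
    (xxzHamiltonian n (torusGraph d L) J 1).HasUniqueGroundState := by
  rw [xxzHamiltonian_one_eq_heisenberg]
  exact LiebMattis.hasUniqueGroundState_of_card_compl_eq n (torusGraph d L) (evenSublattice (d := d) L hL) J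
    (torusGraph_connected_of_proj d L) (torusGraph_isBipartiteWith_evenSublattice (d := d) L hL) hJ
    (card_compl_evenSublattice (d := d) L hL ⟨0, hd⟩)

end Heisenberg

end Torus

section Models

variable {d : ℕ}

/-- A unit vector (`ψ†ψ = 1`) is nonzero. [folklore] -/
private theorem ne_zero_of_dotProduct_eq_one {m : Type*} [Fintype m] {ψ : m → ℂ} (h : star ψ ⬝ᵥ ψ = 1) : ψ ≠ 0 := by
  intro h0; rw [h0, dotProduct_zero] at h; exact zero_ne_one h

/-- **THE ANDERSON TOWER OF STATES OF THE HEISENBERG ANTIFERROMAGNET (Koma–Tasaki 1994, Corollary 2.11 applied as in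
§3.2), conditional on the named fact `theorem_2_4` (= `KomaTasaki.theorem_2_4_holds`).**  Spin `S = n/2`, coupling `J > 0`,
`H_k = J Σ_{⟨x,y⟩} 𝐒_x·𝐒_y = xxzHamiltonian n (torusGraph d (2k+2)) J 1` on the even tori `Λ_k = (ℤ/(2k+2)ℤ)^d` with
`N_k = (2k+2)^d` sites, in the cases where the tree PROVES Néel long-range order of the ground state — `d ≥ 2` and
`(d, S) ≠ (2, ½)` (`xxzAF_ground_planar_of_ne_x`: Dyson–Lieb–Simon / Neves–Perez / Kennedy–Lieb–Shastry / Kubo–Kishi via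
Björnberg–Ueltschi).  THEN there are constants `c₂ > 0` and `c₃` (depending on `d, n, J` only) such that for all large `k`
and EVERY integer `M ≠ 0` with `M² ≤ c₂N_k`:

  `E_k(M) - E_k(0) ≤ c₃ M² / N_k`,

where `E_k(M) = lowestEnergyInSector n H_k M` is the lowest energy in the sector `Sᶻ_tot = M` and `E_k(0) = groundEnergy H_k`
(the ground state is unique and has `Sᶻ_tot = 0`, Lieb–Mattis).  "There exist ever increasing numbers of low-lying
eigenstates whose excitation energies are bounded from above by a constant times `N⁻¹`" — `O(√N_k)` of them: Anderson's
tower.  Inputs, all by name: LRO `exists_pos_eventually_le_of_hasStaggeredEvenTorusLRO`, a long-range-ordered ground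
eigenvector `Matrix.exists_groundState_eigenvector_re_ge`, iv) `u1System_isLROEigenstate`, `Sᶻ_totΦ = 0`
`totalSpin_mulVec_eq_zero_of_heisenberg_groundState`, vi) `rotation_one_comm_hamiltonian` +
`rotation_one_apply_eq_smul_of_hasUniqueGroundState` (uniqueness `hasUniqueGroundState_heisenbergAF`), Theorem 2.4 (`h24`).
[cite: KomaTasaki1994, Corollary 2.11, §3.2 ("Assuming the existence of the Néel order, we can apply our low-lying states
theorems … with γ = 1 … there are low-lying eigenstates with excitation energies not larger than of order N⁻¹")]
[cite: Tasaki2019Tower, Theorem 3.1 (3.9), Corollary 3.2 (3.11), §3.2] -/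
theorem heisenbergAF_andersonTower (h24 : KomaTasaki.theorem_2_4.{0, 0}) (hd : 2 ≤ d) {n : ℕ} (hn : 1 ≤ n)
    (hdn : ¬ (d = 2 ∧ n = 1)) {J : ℝ} (hJ : 0 < J) :
    ∃ c₂ c₃ : ℝ, 0 < c₂ ∧ ∀ᶠ k : ℕ in atTop, ∀ M : ℤ, M ≠ 0 →
      (M : ℝ) ^ 2 ≤ c₂ * Fintype.card (TorusSite d (2 * k + 2)) →
        spinZSector (Λ := TorusSite d (2 * k + 2)) n (M : ℝ) ≠ ⊥ ∧
        lowestEnergyInSector n (xxzHamiltonian n (torusGraph d (2 * k + 2)) J 1) M -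
            (xxzHamiltonian n (torusGraph d (2 * k + 2)) J 1).groundEnergy ≤
          c₃ * (M : ℝ) ^ 2 / Fintype.card (TorusSite d (2 * k + 2)) := by
  have hd1 : 1 ≤ d := by omega
  obtain ⟨a, ha, hev⟩ := exists_pos_eventually_le_of_hasStaggeredEvenTorusLRO (d := d)
    (xxzAF_ground_planar_of_ne_x hd hn hdn hJ zero_le_one le_rfl)
  set μ : ℝ := Real.sqrt a / sNorm n with hμ_def
  have hs : 0 < sNorm n := lt_of_lt_of_le zero_lt_one (one_le_sNorm n)
  have hμ : 0 < μ := div_pos (Real.sqrt_pos.2 ha) hs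
  refine ⟨min (μ ^ 2 / (192 * ((2 * d + 2 : ℕ) : ℝ))) (sNorm n * μ / Real.sqrt 24),
    h24.choose (hbar d n J 1) (sNorm n) (2 * d + 2) μ 1, ?_, ?_⟩
  · refine lt_min (div_pos (pow_pos hμ 2) (by positivity)) (div_pos (mul_pos hs hμ) (by positivity))
  filter_upwards [hev] with k hk M hM0 hM
  have hL : 2 ∣ 2 * k + 2 := ⟨k + 1, by ring⟩
  set H₀ := xxzHamiltonian n (torusGraph d (2 * k + 2)) J 1 with hH₀
  have hH₀herm : H₀.IsHermitian := xxzHamiltonian_isHermitian n _ J 1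
  obtain ⟨Φ, hΦ, hHΦ, -, hlroΦ⟩ := Matrix.exists_groundState_eigenvector_re_ge hH₀herm
    (totalSpin_isHermitian n 2) (HardCoreBoson.commute_xxzHamiltonian_totalSpin_two n _ J 1).eq
    (stagSpin n (torusParityExp d (2 * k + 2)) 0 * stagSpin n (torusParityExp d (2 * k + 2)) 0)
  have hlro' : (μ * sNorm n * (Fintype.card (TorusSite d (2 * k + 2)) : ℝ)) ^ 2 ≤
      (star Φ ⬝ᵥ (stagSpin n (torusParityExp d (2 * k + 2)) 0 *ᵥ
        (stagSpin n (torusParityExp d (2 * k + 2)) 0 *ᵥ Φ))).re := by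
    rw [hμ_def, div_mul_cancel₀ _ hs.ne', mul_pow, Real.sq_sqrt ha.le, Matrix.mulVec_mulVec]
    exact hk.trans hlroΦ
  have hC0 : totalSpin n 2 *ᵥ Φ = 0 :=
    totalSpin_mulVec_eq_zero_of_heisenberg_groundState hd1 (2 * k + 2) hL n hJ hHΦ 2
  have hUΦ := rotation_one_apply_eq_smul_of_hasUniqueGroundState d (2 * k + 2) n J 1 (torusParityExp d (2 * k + 2))
    (ne_zero_of_dotProduct_eq_one hΦ) hHΦ (hasUniqueGroundState_heisenbergAF d (2 * k + 2) n hd1 hL hJ)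
  have h := lowestEnergyInSector_le_of_lro d (2 * k + 2) n h24 J 1 (torusParityExp d (2 * k + 2)) hΦ hHΦ hC0 hμ
    hlro' hUΦ hM0 hM
  refine ⟨h.1, ?_⟩
  have h2 := h.2
  rw [mul_div_assoc] at h2 ⊢
  linarith

/-- **The tower, fixed `M`**: for every integer `M ≠ 0`, eventually along the even tori, the lowest energy in the sector
`Sᶻ_tot = M` exceeds the ground-state energy by at most `c₃M²/N_k` (with `c₃` independent of `M`).
[cite: KomaTasaki1994, Corollary 2.11, §3.2] [cite: Tasaki2019Tower, Corollary 3.2] -/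
theorem heisenbergAF_andersonTower_fixed (h24 : KomaTasaki.theorem_2_4.{0, 0}) (hd : 2 ≤ d) {n : ℕ} (hn : 1 ≤ n)
    (hdn : ¬ (d = 2 ∧ n = 1)) {J : ℝ} (hJ : 0 < J) :
    ∃ c₃ : ℝ, ∀ M : ℤ, M ≠ 0 → ∀ᶠ k : ℕ in atTop,
      spinZSector (Λ := TorusSite d (2 * k + 2)) n (M : ℝ) ≠ ⊥ ∧
        lowestEnergyInSector n (xxzHamiltonian n (torusGraph d (2 * k + 2)) J 1) M -
            (xxzHamiltonian n (torusGraph d (2 * k + 2)) J 1).groundEnergy ≤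
          c₃ * (M : ℝ) ^ 2 / Fintype.card (TorusSite d (2 * k + 2)) := by
  obtain ⟨c₂, c₃, hc₂, hev⟩ := heisenbergAF_andersonTower h24 hd hn hdn hJ
  refine ⟨c₃, fun M hM0 => ?_⟩
  have hN : Tendsto (fun k : ℕ => (Fintype.card (TorusSite d (2 * k + 2)) : ℝ)) atTop atTop := by
    refine tendsto_natCast_atTop_atTop.comp ?_
    refine tendsto_atTop_mono (fun k => ?_) tendsto_id
    rw [card_torusSite]
    calc k ≤ 2 * k + 2 := by omega
      _ = (2 * k + 2) ^ 1 := (pow_one _).symm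
      _ ≤ (2 * k + 2) ^ d := Nat.pow_le_pow_right (by omega) (by omega)
  have hev2 : ∀ᶠ k : ℕ in atTop, (M : ℝ) ^ 2 ≤ c₂ * Fintype.card (TorusSite d (2 * k + 2)) := by
    have h := (hN.const_mul_atTop hc₂).eventually_ge_atTop ((M : ℝ) ^ 2)
    exact h
  filter_upwards [hev, hev2] with k hk hk2
  exact hk M hM0 hk2

/-- **The low-lying eigenstates themselves** (KT94 Corollary 2.11 as printed: "one can find an eigenstate `Φ_Λ^{(M)}` of the
Hamiltonian … orthogonal to the ground state … `E^{(M)} - E^{(0)} ≤ c₃M²/N`"): eventually, for every `M ≠ 0` with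
`M² ≤ c₂N_k`, there is a unit eigenvector `Ψ` of `H_k` with `Sᶻ_totΨ = MΨ`, orthogonal to every ground state, whose
eigenvalue exceeds the ground-state energy by at most `c₃M²/N_k`. [cite: KomaTasaki1994, Corollary 2.11] -/
theorem heisenbergAF_andersonTower_eigenstates (h24 : KomaTasaki.theorem_2_4.{0, 0}) (hd : 2 ≤ d) {n : ℕ} (hn : 1 ≤ n)
    (hdn : ¬ (d = 2 ∧ n = 1)) {J : ℝ} (hJ : 0 < J) :
    ∃ c₂ c₃ : ℝ, 0 < c₂ ∧ ∀ᶠ k : ℕ in atTop, ∀ M : ℤ, M ≠ 0 →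
      (M : ℝ) ^ 2 ≤ c₂ * Fintype.card (TorusSite d (2 * k + 2)) →
        ∃ (Ψ : TensorIndex (TorusSite d (2 * k + 2)) (n + 1) → ℂ) (E : ℝ), star Ψ ⬝ᵥ Ψ = 1 ∧
          totalSpin n 2 *ᵥ Ψ = (M : ℂ) • Ψ ∧ xxzHamiltonian n (torusGraph d (2 * k + 2)) J 1 *ᵥ Ψ = (E : ℂ) • Ψ ∧
          (∀ Φ₀ : TensorIndex (TorusSite d (2 * k + 2)) (n + 1) → ℂ,
            xxzHamiltonian n (torusGraph d (2 * k + 2)) J 1 *ᵥ Φ₀ =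
              ((xxzHamiltonian n (torusGraph d (2 * k + 2)) J 1).groundEnergy : ℂ) • Φ₀ → star Φ₀ ⬝ᵥ Ψ = 0) ∧
          E - (xxzHamiltonian n (torusGraph d (2 * k + 2)) J 1).groundEnergy ≤
            c₃ * (M : ℝ) ^ 2 / Fintype.card (TorusSite d (2 * k + 2)) := by
  have hd1 : 1 ≤ d := by omega
  obtain ⟨c₂, c₃, hc₂, hev⟩ := heisenbergAF_andersonTower h24 hd hn hdn hJ
  refine ⟨c₂, c₃, hc₂, ?_⟩
  filter_upwards [hev] with k hk M hM0 hM
  obtain ⟨hne, hEM⟩ := hk M hM0 hM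
  have hL : 2 ∣ 2 * k + 2 := ⟨k + 1, by ring⟩
  set H₀ := xxzHamiltonian n (torusGraph d (2 * k + 2)) J 1 with hH₀
  obtain ⟨Ψ, hΨmem, hΨ1, hHΨ⟩ := exists_eigenvector_lowestEnergyInSector
    (xxzHamiltonian_isHermitian n (torusGraph d (2 * k + 2)) J 1)
    (HardCoreBoson.commute_xxzHamiltonian_totalSpin_two n (torusGraph d (2 * k + 2)) J 1) hne
  have hCΨ : totalSpin n 2 *ᵥ Ψ = (M : ℂ) • Ψ := by
    simp only [spinZSector, Module.End.mem_eigenspace_iff, Matrix.toLin'_apply, Complex.ofReal_intCast] at hΨmem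
    exact hΨmem
  refine ⟨Ψ, lowestEnergyInSector n H₀ M, hΨ1, hCΨ, hHΨ, fun Φ₀ hΦ₀ => ?_, hEM⟩
  -- orthogonality: `Sᶻ_tot Φ₀ = 0`, `Sᶻ_tot Ψ = M Ψ`, `M ≠ 0`, `Sᶻ_tot` Hermitian
  have hC0 : totalSpin n 2 *ᵥ Φ₀ = 0 := totalSpin_mulVec_eq_zero_of_heisenberg_groundState hd1 (2 * k + 2) hL n hJ hΦ₀ 2
  have h1 : star Φ₀ ⬝ᵥ (totalSpin n 2 *ᵥ Ψ) = (M : ℂ) * (star Φ₀ ⬝ᵥ Ψ) := by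
    rw [hCΨ, dotProduct_smul, smul_eq_mul]
  have h2 : star Φ₀ ⬝ᵥ (totalSpin n 2 *ᵥ Ψ) = 0 := by
    have e : star Φ₀ ᵥ* totalSpin n 2 = star (totalSpin n 2 *ᵥ Φ₀) := by
      rw [star_mulVec, (totalSpin_isHermitian n 2).eq]
    rw [dotProduct_mulVec, e, hC0, star_zero, zero_dotProduct]
  rw [h2] at h1
  have hM0' : (M : ℂ) ≠ 0 := by exact_mod_cast hM0
  exact (mul_eq_zero.1 h1.symm).resolve_left hM0'

/-! ### §5. THE TOWER OF HARD-CORE LATTICE BOSONS AT HALF FILLING (KT94 §3.3: Bose–Einstein condensation) -/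

/-- The hard-core lattice Bose gas with NO staggered field is the spin-½ XY model: `hardCoreLatticeGas d L 0 =
xxzHamiltonian 1 (torusGraph d L) (-1) 0 = -Σ_{⟨x,y⟩}(SˣSˣ + SʸSʸ)` (hopping `-½Σ(a†_xa_y + h.c.)`, `U = ∞`).
[cite: AizenmanEtAl2004, §II, Appendix A] [cite: KomaTasaki1994, §3.3] -/
theorem hardCoreLatticeGas_zero_eq (d L : ℕ) [NeZero L] :
    Literature.Barriers.AtomisticToContinuum.BoseGas.hardCoreLatticeGas d L 0 = xxzHamiltonian 1 (torusGraph d L) (-1) 0 := by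
  rw [Literature.Barriers.AtomisticToContinuum.BoseGas.hardCoreLatticeGas_eq, Complex.ofReal_zero, zero_smul, add_zero]

/-- **Ground-state long-range order of hard-core lattice bosons (pure hopping, half filling) in every `d ≥ 2`** — PLAIN
planar order of the `x`-component of `xxzHamiltonian 1 (torusGraph d L) (-1) 0` along the even tori: Kennedy–Lieb–Shastry
1988 (`d = 2`: the tree's window `hardCoreBoson_ground_planar_spinHalf_x` at `Δ = 0`; `d ≥ 3`: `hardCoreBoson_ground_planar_of_ne_x`).
[cite: KLS1988PRL, Theorem] [cite: KomaTasaki1994, §3.3] -/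
theorem hardCoreBoson_ground_planar_zero_x (hd : 2 ≤ d) :
    HasEvenTorusLRO (fun L x y => groundStateXXZCorrTorus 0 (d := d) L 1 (-1) 0 x y) := by
  rcases Nat.eq_or_lt_of_le hd with h2 | h3
  · subst h2
    exact hardCoreBoson_ground_planar_spinHalf_x 0 (by norm_num) le_rfl
  · exact hardCoreBoson_ground_planar_of_ne_x hd le_rfl (by omega) (by norm_num) le_rfl

/-- **THE TOWER OF STATES OF HARD-CORE LATTICE BOSONS AT HALF FILLING (Koma–Tasaki 1994 §3.3 / Corollary 2.11),
conditional on the named fact `theorem_2_4`.**  `H_j = -Σ_{⟨x,y⟩}(Sˣ_xSˣ_y + Sʸ_xSʸ_y) = xxzHamiltonian 1 (torusGraph d (2(j+1))) (-1) 0`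
(= `hardCoreLatticeGas d (2(j+1)) 0`: hard-core bosons with hopping `½`, no interaction beyond the hard core) on the even tori
`(ℤ/2(j+1)ℤ)^d`, every `d ≥ 2`, `N_j` sites; order operators `O⁽¹⁾ = Sˣ_tot = ½Σ(a_x + a†_x)`, `O⁽²⁾ = Sʸ_tot`, charge
`C = Sᶻ_tot = (particle number) - N_j/2`.  The ground state is unique with `N_j/2` particles (ALSSY 2004 App. A) and has
off-diagonal long-range order (Kennedy–Lieb–Shastry 1988); HENCE there are `c₂ > 0`, `c₃` (depending on `d` only) with: for all
large `j` and every integer `M ≠ 0` with `M² ≤ c₂N_j`, the lowest energy with `N_j/2 + M` particles satisfies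
`E_j(N_j/2 + M) - E_j(N_j/2) ≤ c₃M²/N_j` — the "tower" of the Bose condensate ("we are naturally led to consider ground states
with unconserved particle number").  Inputs by name: LRO `hardCoreBoson_ground_planar_zero_x` +
`exists_pos_eventually_le_of_hasEvenTorusLRO`, uniqueness/half filling `HardCoreBoson.hasUniqueGroundState_hardCoreLatticeGas`,
`HardCoreBoson.groundState_totalSpin_eq_zero`, v)/vi) as in §2, Theorem 2.4 (`h24`).
[cite: KomaTasaki1994, Corollary 2.11, §3.3] [cite: Tasaki2019Tower, §3.2 ("Our theory also applies to the system of hard core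
bosons … the existence of LRO is proved only for M_L = 0"), Corollary 3.2] [cite: AizenmanEtAl2004, Appendix A] -/
theorem hardCoreBoson_andersonTower (h24 : KomaTasaki.theorem_2_4.{0, 0}) (hd : 2 ≤ d) :
    ∃ c₂ c₃ : ℝ, 0 < c₂ ∧ ∀ᶠ j : ℕ in atTop, ∀ M : ℤ, M ≠ 0 →
      (M : ℝ) ^ 2 ≤ c₂ * Fintype.card (TorusSite d (2 * (j + 1))) →
        spinZSector (Λ := TorusSite d (2 * (j + 1))) 1 (M : ℝ) ≠ ⊥ ∧
        lowestEnergyInSector 1 (xxzHamiltonian 1 (torusGraph d (2 * (j + 1))) (-1) 0) M -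
            (xxzHamiltonian 1 (torusGraph d (2 * (j + 1))) (-1) 0).groundEnergy ≤
          c₃ * (M : ℝ) ^ 2 / Fintype.card (TorusSite d (2 * (j + 1))) := by
  have hd0 : 0 < d := by omega
  obtain ⟨a, ha, hev⟩ := exists_pos_eventually_le_of_hasEvenTorusLRO (d := d) (hardCoreBoson_ground_planar_zero_x hd)
  set μ : ℝ := Real.sqrt a / sNorm 1 with hμ_def
  have hs : 0 < sNorm 1 := lt_of_lt_of_le zero_lt_one (one_le_sNorm 1)
  have hμ : 0 < μ := div_pos (Real.sqrt_pos.2 ha) hs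
  refine ⟨min (μ ^ 2 / (192 * ((2 * d + 2 : ℕ) : ℝ))) (sNorm 1 * μ / Real.sqrt 24),
    h24.choose (hbar d 1 (-1) 0) (sNorm 1) (2 * d + 2) μ 1, ?_, ?_⟩
  · refine lt_min (div_pos (pow_pos hμ 2) (by positivity)) (div_pos (mul_pos hs hμ) (by positivity))
  filter_upwards [hev] with j hj M hM0 hM
  have hL : Even (2 * (j + 1)) := even_two_mul _
  set H₀ := xxzHamiltonian 1 (torusGraph d (2 * (j + 1))) (-1) 0 with hH₀
  have hH₀herm : H₀.IsHermitian := xxzHamiltonian_isHermitian 1 _ (-1) 0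
  obtain ⟨Φ, hΦ, hHΦ, -, hlroΦ⟩ := Matrix.exists_groundState_eigenvector_re_ge hH₀herm
    (totalSpin_isHermitian 1 2) (HardCoreBoson.commute_xxzHamiltonian_totalSpin_two 1 _ (-1) 0).eq
    (stagSpin 1 (fun _ : TorusSite d (2 * (j + 1)) => 0) 0 * stagSpin 1 (fun _ : TorusSite d (2 * (j + 1)) => 0) 0)
  have hlro' : (μ * sNorm 1 * (Fintype.card (TorusSite d (2 * (j + 1))) : ℝ)) ^ 2 ≤
      (star Φ ⬝ᵥ (stagSpin 1 (fun _ : TorusSite d (2 * (j + 1)) => 0) 0 *ᵥ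
        (stagSpin 1 (fun _ : TorusSite d (2 * (j + 1)) => 0) 0 *ᵥ Φ))).re := by
    rw [hμ_def, div_mul_cancel₀ _ hs.ne', mul_pow, Real.sq_sqrt ha.le, Matrix.mulVec_mulVec]
    exact hj.trans hlroΦ
  have hGS : Φ ∈ (Literature.Barriers.AtomisticToContinuum.BoseGas.hardCoreLatticeGas d (2 * (j + 1)) 0).groundSpace := by
    rw [hardCoreLatticeGas_zero_eq]; exact (Matrix.mem_groundSpace_iff _ _).2 hHΦ
  have hC0 : totalSpin 1 2 *ᵥ Φ = 0 := HardCoreBoson.groundState_totalSpin_eq_zero hd0 hL 0 hGS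
  have huniq : H₀.HasUniqueGroundState := by
    rw [hH₀, ← hardCoreLatticeGas_zero_eq]; exact HardCoreBoson.hasUniqueGroundState_hardCoreLatticeGas hd0 hL 0
  have hUΦ := rotation_one_apply_eq_smul_of_hasUniqueGroundState d (2 * (j + 1)) 1 (-1) 0
    (fun _ : TorusSite d (2 * (j + 1)) => 0) (ne_zero_of_dotProduct_eq_one hΦ) hHΦ huniq
  have h := lowestEnergyInSector_le_of_lro d (2 * (j + 1)) 1 h24 (-1) 0 (fun _ => 0) hΦ hHΦ hC0 hμ hlro' hUΦ hM0 hM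
  refine ⟨h.1, ?_⟩
  have h2 := h.2
  rw [mul_div_assoc] at h2 ⊢
  linarith

/-- **The low-lying eigenstates of the Bose gas, in particle-number language**: eventually, for every `M ≠ 0` with `M² ≤ c₂N_j`
there is a unit eigenvector `Ψ` of `H_j` with exactly `N_j/2 + M` bosons (`(Σ_x n_x)Ψ = (N_j/2 + M)Ψ`), orthogonal to the
(unique, half-filled) ground state, with eigenvalue at most `E_j(0) + c₃M²/N_j`. [cite: KomaTasaki1994, Corollary 2.11, §3.3]
[cite: AizenmanEtAl2004, Appendix A] -/
theorem hardCoreBoson_andersonTower_eigenstates (h24 : KomaTasaki.theorem_2_4.{0, 0}) (hd : 2 ≤ d) :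
    ∃ c₂ c₃ : ℝ, 0 < c₂ ∧ ∀ᶠ j : ℕ in atTop, ∀ M : ℤ, M ≠ 0 →
      (M : ℝ) ^ 2 ≤ c₂ * Fintype.card (TorusSite d (2 * (j + 1))) →
        ∃ (Ψ : TensorIndex (TorusSite d (2 * (j + 1))) 2 → ℂ) (E : ℝ), star Ψ ⬝ᵥ Ψ = 1 ∧
          (∑ x : TorusSite d (2 * (j + 1)), HardCoreBoson.num x) *ᵥ Ψ =
            ((Fintype.card (TorusSite d (2 * (j + 1))) : ℂ) / 2 + M) • Ψ ∧
          xxzHamiltonian 1 (torusGraph d (2 * (j + 1))) (-1) 0 *ᵥ Ψ = (E : ℂ) • Ψ ∧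
          (∀ Φ₀ : TensorIndex (TorusSite d (2 * (j + 1))) 2 → ℂ,
            xxzHamiltonian 1 (torusGraph d (2 * (j + 1))) (-1) 0 *ᵥ Φ₀ =
              ((xxzHamiltonian 1 (torusGraph d (2 * (j + 1))) (-1) 0).groundEnergy : ℂ) • Φ₀ → star Φ₀ ⬝ᵥ Ψ = 0) ∧
          E - (xxzHamiltonian 1 (torusGraph d (2 * (j + 1))) (-1) 0).groundEnergy ≤
            c₃ * (M : ℝ) ^ 2 / Fintype.card (TorusSite d (2 * (j + 1))) := by
  have hd0 : 0 < d := by omega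
  obtain ⟨c₂, c₃, hc₂, hev⟩ := hardCoreBoson_andersonTower h24 hd
  refine ⟨c₂, c₃, hc₂, ?_⟩
  filter_upwards [hev] with j hj M hM0 hM
  obtain ⟨hne, hEM⟩ := hj M hM0 hM
  have hL : Even (2 * (j + 1)) := even_two_mul _
  set H₀ := xxzHamiltonian 1 (torusGraph d (2 * (j + 1))) (-1) 0 with hH₀
  obtain ⟨Ψ, hΨmem, hΨ1, hHΨ⟩ := exists_eigenvector_lowestEnergyInSector
    (xxzHamiltonian_isHermitian 1 (torusGraph d (2 * (j + 1))) (-1) 0)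
    (HardCoreBoson.commute_xxzHamiltonian_totalSpin_two 1 (torusGraph d (2 * (j + 1))) (-1) 0) hne
  have hCΨ : totalSpin 1 2 *ᵥ Ψ = (M : ℂ) • Ψ := by
    simp only [spinZSector, Module.End.mem_eigenspace_iff, Matrix.toLin'_apply, Complex.ofReal_intCast] at hΨmem
    exact hΨmem
  refine ⟨Ψ, lowestEnergyInSector 1 H₀ M, hΨ1, ?_, hHΨ, fun Φ₀ hΦ₀ => ?_, hEM⟩
  · rw [HardCoreBoson.sum_num_eq_totalSpin_add, Matrix.add_mulVec, hCΨ, Matrix.smul_mulVec, Matrix.one_mulVec, add_smul]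
    exact add_comm _ _
  · have hGS : Φ₀ ∈ (Literature.Barriers.AtomisticToContinuum.BoseGas.hardCoreLatticeGas d (2 * (j + 1)) 0).groundSpace := by
      rw [hardCoreLatticeGas_zero_eq]; exact (Matrix.mem_groundSpace_iff _ _).2 hΦ₀
    have hC0 : totalSpin 1 2 *ᵥ Φ₀ = 0 := HardCoreBoson.groundState_totalSpin_eq_zero hd0 hL 0 hGS
    have h1 : star Φ₀ ⬝ᵥ (totalSpin 1 2 *ᵥ Ψ) = (M : ℂ) * (star Φ₀ ⬝ᵥ Ψ) := by
      rw [hCΨ, dotProduct_smul, smul_eq_mul]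
    have h2 : star Φ₀ ⬝ᵥ (totalSpin 1 2 *ᵥ Ψ) = 0 := by
      have e : star Φ₀ ᵥ* totalSpin 1 2 = star (totalSpin 1 2 *ᵥ Φ₀) := by
        rw [star_mulVec, (totalSpin_isHermitian 1 2).eq]
      rw [dotProduct_mulVec, e, hC0, star_zero, zero_dotProduct]
    rw [h2] at h1
    have hM0' : (M : ℂ) ≠ 0 := by exact_mod_cast hM0
    exact (mul_eq_zero.1 h1.symm).resolve_left hM0'

end Models

end XXZKT

end Literature.MathematicalPhysics.QuantumLattice
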